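import Mathlib
import HarnessLib
import HarnessLib.Audit
import Summits.AtomisticToContinuum.Statement
import Literature.MathematicalPhysics.QuantumManyBody.PeriodicBoseGas
import Literature.MathematicalPhysics.QuantumManyBody.NeumannMomentumCutoffs
import HarnessLib.Audit.Status.Attr

/-!
Route: BECJosephsonSlackThreshold

DORMANT since 2026-08-22T17:43:27Z (reconciler: no traction for 5.5 d (last activity item-evidence-added at 2026-08-17T04:19:48Z); parked, not closed — `ledger route dormant route-AtomisticToContinuum-BECJosephsonSlackThreshold --off` t) — unstaffed, not closed; items shared with open routes are served there. `ledger route dormant <id> --off` reactivates.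

# Route BECJosephsonSlackThreshold — Josephson threshold — condensation of all κN/L²-near-minimisers
decides BEC, and the number filter f(Σχ(xⱼ))·Ψ proves no coarser energy information can

THRESHOLD ROUTE realising card number-filter-energy-blindness (conforming re-open, D-0027 §2.1, of
the retired routes
NumberFilterBlindness / BECJosephsonThreshold: same statements; assembly and `closes` now conclude
the Statement decl `_root_.BoseEinsteinCondensation` BY NAME). "It suffices to show X" =
JosephsonSlackCondensation: for every
repulsive finite-range v there is ρ₀ > 0 such that for 0 < ρ < ρ₀ there are c, κ > 0 with: for all
large N, EVERY Dirichlet trial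
state Ψ on the box of side L = (N/ρ)^{1/3} with ⟨Ψ, H_N Ψ⟩ ≤ E₀(N, L) + κN/L² has λ_max(γ_Ψ) ≥ cN. X
→ conjunct is the proved
deciding theorem `closes` (le_condensateNumber with δ = κN/L²; folder glue.lean, sorry-free). The
route's content is that X is the
EXACT threshold form of every energy-currency attack and that this is a theorem, not numerology: the
two ranked cruxes
FilterFragmentation (the number filter — a positive configuration-space multiplier F = Π_c
f_{k_c}(Σ_j χ_c(x_j)) with windows of
width < 1 in each smooth cell count, exact IMS cost ≤ C K²N/L², exact vanishing of inter-cell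
coherence; scale-free, model-free)
and NearMinimiserSlabConcentration (Lieb–Yngvason cell convexity, leading order, in tree) compose
(support BlindnessAssembly, proved
in the folder sketch) to JosephsonScaleBlindness: per v and per c > 0 there is C (independent of ρ,
N) with trial states of energy
≤ E₀ + C·N/L² and λ_max ≤ cN. So slack κN/L² with κ small is the weakest energy-only hypothesis that
can imply BEC (X), slack
C(c)N/L² already admits fragmented states (blindness), and everything coarser — LHY precision
o(ρa√(ρa³))N, any N^{1/3+ε} slack —
certifies no occupation of ANY mode. BECPinning's PinnedLowerBound implies X; X is filed once here
as the shared, mode-free target.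
Lean: `∀ v : ℝ → ENNReal,
Literature.MathematicalPhysics.QuantumManyBody.BoseGas.IsRepulsiveFiniteRange v → ∃ ρ₀ : ℝ, 0 < ρ₀ ∧
∀ ρ : ℝ, 0 < ρ → ρ < ρ₀ → ∃ c κ : ℝ, 0 < c ∧ 0 < κ ∧ ∀ᶠ N : ℕ in Filter.atTop, ∀ Ψ :
Literature.MathematicalPhysics.QuantumManyBody.BoseGas.TrialState N
(Literature.MathematicalPhysics.QuantumManyBody.BoseGas.sideLength ρ N),
Literature.MathematicalPhysics.QuantumManyBody.BoseGas.energy v Ψ ≤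
Literature.MathematicalPhysics.QuantumManyBody.BoseGas.groundStateEnergy v N
(Literature.MathematicalPhysics.QuantumManyBody.BoseGas.sideLength ρ N) + ENNReal.ofReal (κ * N /
Literature.MathematicalPhysics.QuantumManyBody.BoseGas.sideLength ρ N ^ 2) → ENNReal.ofReal (c * N)
≤ Literature.MathematicalPhysics.QuantumManyBody.BoseGas.maxOccupation N Ψ.ψ`

## Assembly
The route decides the conjunct through X alone: `theorem closes : JosephsonSlackCondensation →
BoseEinsteinCondensation` is PROVED in
the folder's glue.lean / Sketch2.lean (axioms propext, Classical.choice, Quot.sound): unpack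
HasGroundStateBEC, take δ :=
ofReal(κN/L²) > 0 for N ≥ 1 (L = (N/ρ)^{1/3} > 0), and apply
Literature.MathematicalPhysics.QuantumManyBody.BoseGas.le_condensateNumber
to the hypothesis. The Assembly item below records the same implication as a statement (a prover
closes it with the 15-line proof of
`closes`). The negative face composes separately: BlindnessAssembly (support, proved in the sketch)
takes FilterFragmentation and
NearMinimiserSlabConcentration to JosephsonScaleBlindness; together X and JosephsonScaleBlindness
bracket the truth at the single scale
N/L² (κ small ⇒ condensation; C(c) large ⇒ fragmentation).

Rationale: WHY THIS LINE. Mechanism: Lieb–Solovej number localisation (LiebSolovej2001 = LSSY2005 Thm 10.6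
p.105: restricting an approximate ground state to
a window of M values of a number operator costs C/M² × off-diagonal energy) and the IMS localisation
formula (CyconEtAl1987 Thm 3.2;
Lewin2011 §3 geometric localisation) run BACKWARDS — not to localise n₊ and use the energy, but to
localise the relative number of
macroscopic cells and defeat it: a window of width < 1 in the smooth count Σ_j χ_c(x_j) makes the
one-particle density matrix of the
filtered state vanish identically between cell interiors (number–phase conjugacy of fragmentation,
MuellerEtAl2006 §II, Leggett2001
§VI; dictionary: window width ↔ relative-number uncertainty, ∫|∇F|²|Ψ|² ↔ Josephson coupling energy
∝ N/L²) at the exact price of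
the pointwise IMS identity. Imported areas: spectral-theory localisation and two-mode condensate
physics; the only property of the
unknown near-minimiser that is needed — concentration of macroscopic slab counts — comes from
Lieb–Yngvason cell convexity, PROVED
in the tree (LSSY2005_lowerBound_neumann_holds, LSSY2005_superadditivity,
sum_locGroundStateEnergy_mul_le_setLIntegral_cellSet,
LSSY2005_upperBound_periodic_holds), so no LHY-order input enters. What it does that prior items do
not: the deciding crux X is the
mode-free, linear-deficit-free weakening of BECPinning.PinnedLowerBound
(stmt-AtomisticToContinuum-0848) — the form every pinning /
twist-response / Landau-sector line ultimately needs — and the negative cruxes make its slack scale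
a theorem: PhaseTwistObstruction
(stmt-0852) and card energy-blindness-bessel-witness are v = 0 / fixed-mode witnesses (a phase
e^{iΣθ(x_j)} is unitary on γ, so
λ_max is untouched; that card's mode-free item W3 needs an unproved LLN), whereas the filter is
per-v, interacting and mode-free with
no LLN, and it explains Junge2026's reach a(ρa³)^{-3/4} (C·N/L² = LHY precision) as intrinsic to
energy information.

RANKED CRUXES. #2 FilterFragmentation (crux) — THE NUMBER-FILTER LEMMA (card mechanism; scale-free,
model-free). For every c > 0 there are K ∈ ℕ and C ≥ 0 such that for every repulsive finite-range v,
every N, every L > 0 and every Dirichlet trial state Ψ on Λ_L whose slab counts are concentrated —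
the |Ψ|²-probability that one of the K slabs {x : x₁ ∈ [iL/K,(i+1)L/K)} holds more than 4N/K
particles is ≤ 1/K² — and every slack δ with ⟨Ψ,HΨ⟩ ≤ E₀(N,L) + δ, there is a Dirichlet trial state
Φ with ⟨Φ,HΦ⟩ ≤ E₀(N,L) + 4δ + C·N/L² and λ_max(γ_Φ) ≤ cN. Construction: M = ⌈12/c⌉ cells (blocks of
slabs) separated by single-slab layers, smooth partition χ_c (Σ_c χ_c = 1, |∇χ_c| ≤ C₀K/L), smooth
counts Ñ_c = Σ_j χ_c(x_j), joint filter F_k = Π_c f_{k_c}(Ñ_c) with Σ_k f_k² = 1, supp f_k of width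
0.9 < 1, Σ_k f_k'² bounded; pointwise IMS: Σ_k |∇(F_kΨ)|² = |∇Ψ|² + (Σ_k|∇F_k|²)|Ψ|², Σ_k|∇F_k|² ≤ C
K²N/L²; Markov selection of one window k (excess energy ≤ 4(δ + cost): weight 1/4; layer load ≤
4·E_Ψ: weight 1/4; unbalanced windows: weight ≤ 1/K²); in Φ = F_kΨ/‖F_kΨ‖ the coherence between
distinct cell interiors vanishes identically (f(n)f(n+1) = 0, pointwise in the other coordinates),
cell loads are ≤ cN/2 on the support, layer load ≤ εN in mean, hence ⟨φ,γ_Φ φ⟩ ≤ (√(cN/2)·‖φ_cells‖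
+ √(εN)·‖φ_layers‖)² ≤ cN by Cauchy–Schwarz per block and Minkowski. [difficulty: L] (why it might
fail: λ_max is bounded through the cell/layer LOADS of Φ: windows pin cell loads pointwise but layer
loads only via Markov, jointly with the energy excess and window balance (weights 1/4+1/4+K⁻²<1); if
the layer population could not be made ≤ εN at width L/K for concentrated Ψ, c < 4ε is out of
reach.) [LiebSolovej2001, LSSY2005, CyconEtAl1987, Lewin2011, MuellerEtAl2006, Leggett2001]
#3 NearMinimiserSlabConcentration (crux) — For every repulsive finite-range v and every K ≥ 1 there
is ρ₀ > 0 such that for 0 < ρ < ρ₀ and all large N there is a Dirichlet trial state Ψ on the box of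
side L = (N/ρ)^{1/3} with ⟨Ψ,HΨ⟩ ≤ E₀ + N/L² whose slab counts are concentrated in the sense of
FilterFragmentation (|Ψ|²-probability that some slab of width L/K along x₁ holds > 4N/K particles is
≤ 1/K²). Route to it: for a > 0, ANY Ψ with slack N/L² has energy ≤ 4πaρN(1+ε) (DirichletUpperBound;
N/L² = o(ρaN)), while the state-level cell decomposition into K³ Neumann cubes of side ℓ = L/K (in
tree: sum_locGroundStateEnergy_mul_le_setLIntegral_cellSet pattern) gives energy ≥ E_Ψ[Σ_cubes
E₀^Neu(n_c, ℓ)] with, per cube, LSSY Thm 2.4 in Neumann form (LSSY2005_lowerBound_neumann_holds: 4πa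
n_c²/ℓ³(1 − CY_c^{1/17}) for n_min ≤ n_c ≤ Dn̄), superadditivity blocks for n_c > Dn̄
(LSSY2005_superadditivity.mul_le) and E₀ ≥ 0 for n_c < n_min ~ (ℓ/a)^{1/6} ≪ n̄ = N/K³; subtracting
the tangent at n̄ leaves a Huber-type deviation Σ_c E_Ψ min((n_c−n̄)², Dn̄|n_c−n̄|) ≤ C(ε + Y^{1/17}
+ o(1))·N n̄, and Chebyshev gives the slab statement once C(ε + Y^{1/17})K⁵ is small (ρ < ρ₀(K, v),
N large); for a = 0 (v = 0 a.e., free functional) take the sine-product ground state and binomial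
concentration. [deps: DirichletUpperBound] [difficulty: L] (why it might fail: Needs E₀^Dir ≤
4πaρN(1+o(1)) (only periodic Thm 2.2 is in tree), a SECOND-MOMENT form of the LY cell bound incl.
cubes with n ≫ p particles (superadditivity blocks) and the a = 0 reduction; false if
near-minimisers at slack N/L² can be Schrödinger cats of macroscopically different profiles.)
[LSSY2005, LiebYngvason1998, Dyson1957, LiebSeiringerSolovejYngvason2005]
#4 JosephsonSlackCondensation (crux) — X, THE DECIDING CRUX (positive face of the threshold): for
every repulsive finite-range v there is ρ₀ > 0 such that for 0 < ρ < ρ₀ there are c, κ > 0 with: for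
all large N, EVERY Dirichlet trial state Ψ on the box of side L = (N/ρ)^{1/3} with ⟨Ψ,HΨ⟩ ≤ E₀ +
κN/L² has λ_max(γ_Ψ) ≥ cN. Mode-free and without a linear-in-slack deficit, hence implied by
BECPinning.PinnedLowerBound (given E₀ < ⊤: occupation of u ≥ N(1 − C√(ρa³)) − N/4 ≥ N/4) and by any
twist-response / Landau-sector bound at scale N/L²; implies the conjunct by `closes`. Not decomposed
here by design: this route supplies the proof that nothing with larger slack can replace it, and the
common target the energy-currency routes attach to. [difficulty: open-problem] (why it might fail:
It is thermodynamic-limit BEC uniformly over all κN/L²-near-minimisers — stronger than the conjunct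
(δ chosen after N); no kinetic gap survives L → ∞ (ChongLiangNam2026 §1), and a soft non-phonon
branch re-condensing ⊥ the condensate at cost o(N/L²) would refute every κ > 0.) [Junge2026,
FournaisEtAl2024, LiebSeiringer2002, NamRougerieSeiringer2016, ChongLiangNam2026, LSSY2005]
#9 JosephsonScaleBlindness (support) — THE NEGATIVE FACE (card item N1, mode-free): per v
(repulsive, finite range) and per c > 0 there are C (independent of ρ, N) and ρ₀ such that for ρ <
ρ₀ and all large N some Dirichlet trial state on the box of side (N/ρ)^{1/3} has energy ≤ E₀ +
C·N/L² and λ_max(γ) ≤ cN. Follows from FilterFragmentation + NearMinimiserSlabConcentration by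
BlindnessAssembly (C := 4 + C_A(c)); candidate catalogue entry
Literature/Barriers/AtomisticToContinuum/JosephsonScaleEnergyBlindness once proved; it caps
BECPinning's κ: κ(1 − c − C√(ρa³)) ≤ C(c) for every c. [difficulty: M] [LSSY2005, LiebSolovej2001,
Junge2026, Fournais2020, MuellerEtAl2006]
#9 BlindnessAssembly (support) — FilterFragmentation → NearMinimiserSlabConcentration →
JosephsonScaleBlindness: given v and c take K(c), C_A(c) from the filter lemma and ρ₀(v, K) from the
concentration crux; for ρ < ρ₀ and large N (N ≥ 1, so L > 0) feed the concentrated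
N/L²-near-minimiser to the filter with δ = ofReal(N/L²): slack 4N/L² + C_A N/L² = (4 + C_A)N/L².
Pure logic plus ENNReal arithmetic — PROVED sorry-free in the folder's Sketch2.lean
(blindnessAssembly_holds, 20 lines) for a prover to transcribe. [difficulty: provable-now]
[LSSY2005]
#9 DirichletUpperBound (support) — Leading-order Dirichlet upper bound in the thermodynamic limit:
for repulsive finite-range v with 0 < a < ∞ (a = scattering length) and every ε > 0 there is ρ₀ > 0
such that for 0 < ρ < ρ₀ and all large N, E₀^Dir(N, (N/ρ)^{1/3}) ≤ 4πaρN(1+ε). From the in-tree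
periodic Thm 2.2 (LSSY2005_upperBound_periodic_holds: 4πρ₁a(1 + C a/b), a/b ~ (ρa³)^{1/3}) applied
to a translation-averaged periodic near-minimiser times a product boundary cutoff Π_j h(x_j) with h
AND ∇h vanishing on ∂Λ (h = 1 at distance b = √L from the walls, so HΨ extends by zero to a C¹
Dirichlet trial state): ∫|∇(HΨ)|² = ∫H²|∇Ψ|² − ∫HΔH|Ψ|², cost ≤ (C/b²)·E[#particles within b of the
walls] = O(N/(bL)) = o(N), mass loss O(b/L); v ≤ v^per keeps the interaction. LSSY (2.8): e₀(ρ) is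
independent of boundary conditions. [difficulty: M] [LSSY2005, Dyson1957,
LiebSeiringerSolovejYngvason2005]

TWO-LAYER PLAN. NearMinimiserSlabConcentration ⇐ DirichletUpperBound → CellCountConcentration →
NearMinimiserSlabConcentration, where
CellCountConcentration = for a > 0 every Ψ with energy ≤ 4πaρN(1+ε) has Σ_cubes E_Ψ min((n_c − n̄)²,
Dn̄|n_c − n̄|) ≤ C(ε + Y^{1/17})·N·n̄
over K³ macroscopic Neumann cubes (Thm 2.4 per cube + superadditivity + tangent subtraction: the
convexity remainder LSSY's
(2.52)–(2.57) discard, kept); the a = 0 case rides as a `--supports` lemma. FilterFragmentation ⇐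
FilterTrialState (closure of
TrialState under F = Π_c f(Σ_jχ_c(x_j)) with the pointwise IMS identity Σ_k kineticDensity(F_kΨ) =
kineticDensity Ψ + (Σ_k|∇F_k|²)|Ψ|²)
→ BlockOccupationBound (occupation of any normalised φ in a width-<1 filtered state ≤ (√(max cell
load)·‖φ_cells‖ + √(layer
load)·‖φ_layers‖)²) → FilterFragmentation. JosephsonSlackCondensation is NOT split here: its
decompositions are the other routes'
theses (BECPinning: GroundStateEnergyFinite → PinnedLowerBound → X; twist/Landau-sector lines),
which attach to X. Foreseen
sharpenings, not filed: the periodic twin of the blindness statement; a box-uniform version on L ≥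
a(ρa³)^{-3/4-s} (Junge-exponent
optimality); the catalogue entry
Literature/Barriers/AtomisticToContinuum/JosephsonScaleEnergyBlindness vendored from the Theorems
file.

KILL CRITERIA. ¬JosephsonSlackCondensation for some admissible v (for every κ > 0,
κN/L²-near-minimisers with λ_max = o(N) at arbitrarily small ρ)
closes the route `refuted:JosephsonSlackCondensation` — and is first-rank negative knowledge: no
energy-currency argument (pinning,
penalties, localisation) can ever prove the conjunct; BECPinning dies with it (its own kill
criterion). ¬NearMinimiserSlabConcentration
(near-minimisers at slack N/L² with macroscopic number fluctuations at every small ρ) forces a pivot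
of the negative face to the
periodic setting with translation averaging (restate; the deciding chain is untouched) unless it is
an artefact of the 4N/K / K⁻²
thresholds (then restate with AN/K). ¬FilterFragmentation would mean inter-cell coherence survives
width-<1 windows, contradicting a
pointwise identity — if produced nevertheless, the card is dead and the route keeps only X (then
close `superseded` by BECPinning).
X proved on another route fulfils this one (shared item); JosephsonScaleBlindness proved elsewhere
(Bessel textures + an LLN) moots
the two ranked cruxes but not the route.

NOT DECOMPOSED YET. The deciding crux X (deliberately: see Two-layer plan); constants K(c) ≈ 10³/c²,
C(c) ≈ 10²·K(c)²; the C¹/TrialState closure and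
normalisation of filtered states; measurability of the slab-count event; the second-moment LY
bookkeeping and the a = 0 reduction
(scatteringLength v = 0 ⇒ v = 0 a.e. ⇒ free functional); the cutoff construction behind
DirichletUpperBound; ScatteringLengthFinite and
GroundStateEnergyFinite (stmt-AtomisticToContinuum-0851/0850, shared with BECPinning). No
second-order (LHY) energy input is used anywhere.

CHEAPEST FALSIFIER. Free gas v = 0 (admissible): E₀ = 3π²N/L²; X holds there with any κ < 3π²(1 − c)
(one-body Dirichlet gap: slack κN/L² forces
occupation ≥ (1 − κ/3π²)N of the sine mode), and JosephsonScaleBlindness holds with C(c) ≈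
40c^{-2/3} (symmetrised product of ⌈1/c⌉
low modes) — both faces consistent, threshold visibly at N/L². The lookup that would grade the
negative face `known`: a printed theorem
'approximate ground states of the 3-D dilute interacting gas with N^{1/3+}-excess energy need not
condense (λ_max/N → 0)' — searched
2026-08-15 (Novelty), not found. Logic check run: Sketch2.lean elaborates (rc 0), `closes` and
blindnessAssembly_holds are proved there.

NUMBERS. N/L² = ρ^{2/3}N^{1/3}. LHY precision ρa(ρa³)^{1/2}·N equals C·N/L² at L* = √C·a(ρa³)^{-3/4}
= √C·ξ(ρa³)^{-1/4}, ξ = (ρa)^{-1/2}: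
Junge2026 Cor. 6 / Remark 7 reach a(ρa³)^{-3/4-η}; Fournais2020 Thm 1.2 boxes
C(ρa³)^{-δ}(ρa)^{-1/2}; LSSY Thm 5.1 (KineticGapLengthScales)
ρaL² = const. Free Dirichlet gap 3π²/L²; BECPinning's recorded envelope κ(1 − C√(ρa³)) ≤ 4π²
(periodic boost); blindness caps κ further by
κ(1 − c − C√(ρa³)) ≤ C(c). LY Thm 2.4: relative error CY^{1/17}, boxes L/a > C'Y^{-6/17} (in tree).
Filter bookkeeping: window width 0.9,
overlap 0.3, Σ_k f_k'² ≲ 30, M = ⌈12/c⌉ cells, layer fraction ε ≤ 0.085c, K ≥ 235M/c. LSSY2005 Thm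
10.6 (p.105): cost C M⁻² Σ_{k<M} k²|d_k|
+ C Σ_{k≥M}|d_k| — the 1/w² law of the filter. Items at open: 7 (3 cruxes, 3 support, assembly) +
the deciding theorem.

DEFINITION REQUESTS. None. All items are typed over
Literature.MathematicalPhysics.QuantumManyBody.BoseGas.{TrialState, Config, energy,
groundStateEnergy,
maxOccupation, sideLength, IsRepulsiveFiniteRange, scatteringLength, BoseEinsteinCondensation} (lean
search --decl:
BoseEinsteinCondensation.lean, PeriodicBoseGas.lean); slab counts are inlined as
`(Finset.univ.filter fun j => X j 0 ∈ Set.Ico (iL/K) ((i+1)L/K)).card`.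
A small `slabCount` / smooth-count API would shorten the two ranked cruxes — a prover's `--supports`
lemma, not a definition item.

Novelty: Searches (2026-08-15): `lit frontier AtomisticToContinuum --since 2021` (30 rows; BEC descendants
arXiv:2603.20776, arXiv:2510.20493,
arXiv:2602.16566 — none on fragmentation witnesses); `lit bridges AtomisticToContinuum --cross any`
(30 rows, nothing specific);
`lit search --hybrid "localization of large matrices number of particles window"` (8; →
book:lieb2005-mathematics-bose-gas-its-condensation
p.105 Thm 10.6, read) and `--hybrid "geometric localization Fock space smooth partition of unity
particles in a ball"` (8; → same book
pp.101–103); `lit search --source zbmath "Geometric methods for nonlinear many-body quantum systems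
Lewin"` (1: doi:10.1016/j.jfa.2010.11.017 =
arXiv:1009.2836), `--source zbmath "fragmented condensate energy cost number fluctuations bosons two
modes"` (0), `--source zbmath
"Lieb Solovej charged Bose gas"` (8; → doi:10.1007/s002200000353); `--source crossref "geometric
localization Fock space many-body bosons …"`
(10, many-body-localisation physics only); openalex / arXiv HTTP 429; `lit galaxy search "fragmented
condensate energy cost superselection …"
--star all` and `"IMS localization formula partition of unity particle number many-body" --star all`
(galaxyd queued too long, 0 rows);
`ledger negatives --problem AtomisticToContinuum` (0); in tree: BECPinning
stmt-AtomisticToContinuum-0848/0852, card energy-blindness-bessel-witness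
(audit-6: variant), this card's audit-15 (new-combination), the retired record file
Theses/NumberFilterBlindness.lean  [refs: 10.1016/j.jfa.2010.11.017, 10.1007/s002200000353, 2603.20776, 2510.20493, 2602.16566, 1009.2836, book:lieb2005-mathematics-bose-gas-its-condensation, doi:10.1016/j.jfa.2010.11.017, doi:10.1007/s002200000353, LiebSolovej2001, LSSY2005, CyconEtAl1987, Lewin2011, LiebSeiringer2002, NamRougerieSeiringer2016]

Barriers (technique_class: negative-witness number-filter josephson-scale): - technique_class: negative-witness number-filter josephson-scale
- Literature.Barriers.AtomisticToContinuum.KineticGapLengthScales: the deciding crux X does NOT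
evade it — it is exactly the gap-free relative statement at L = (N/ρ)^{1/3} that the barrier says no
printed argument reaches; the bet is that X is the right SHAPE (mode-free, slack κN/L²) for
whichever non-gap mechanism lands (pinning response, twist stiffness, Landau sector), and the
route's proved content explains the barrier: gap methods turn L² × (excess per particle) into
depletion, void once the excess exceeds C/L² per particle, i.e. beyond L* = a(ρa³)^{-3/4} at LHY
precision.
- Literature.Barriers.AtomisticToContinuum.EnergyAsymptoticsWithoutCondensation: the negative face
EXTENDS the entry (1-D Lieb–Liniger witness) to a 3-D, in-class, per-v quantitative statement with
threshold N/L²; X sits exactly at the threshold the extension leaves open, so the entry does not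
bite on X.
- Literature.Barriers.AtomisticToContinuum.EnergyAsymptoticsWithoutCondensationNarrow: consistent
with its scope note (d = 3 energy inferences with extra infrared structure are not excluded): the
route states how much extra structure — slack below C(c)N/L² (X), or non-energetic input.
- Literature.Barriers.AtomisticToContinuum.CasimirBoxGeneralizedCondensation: same moral at T = 0
with interactions: filtered states are 'fragmented/generalised condensates' manufactured below
energy resolution N/L²; X is immune because it quantifies over a

History (route lifecycle, newest last):
- 2026-08-22T17:43:27Z · DORMANT — reconciler: no traction for 5.5 d (last activity item-evidence-added at 2026-08-17T04:19:48Z); parked, not closed — `ledger route dormant route-AtomisticToConti (operator:999:2057669)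

sub-problem: BoseEinsteinCondensation · status: dormant · opened planner-plancard-AtomisticToContinuum-BoseEin-e6a487b2-0 2026-08-15T14:24:09Z · rev 7 · ledger route-AtomisticToContinuum-BECJosephsonSlackThreshold
GENERATED by the gate from the ledger (D-0016/17). Provers cite these decls: `theorem foo : Summit.AtomisticToContinuum.BoseEinsteinCondensation.Theses.BECJosephsonSlackThreshold.<Decl> := …` in Summits/AtomisticToContinuum/BoseEinsteinCondensation/Theorems/<Name>.lean.
-/

namespace Summit.AtomisticToContinuum.BoseEinsteinCondensation.Theses.BECJosephsonSlackThreshold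

open scoped BigOperators Topology Manifold Classical MeasureTheory ProbabilityTheory Matrix InnerProductSpace ComplexConjugate ContinuousMap
open Filter Set Function TopologicalSpace MeasureTheory

attribute [summit_statement] _root_.BoseEinsteinCondensation

/-- item stmt-AtomisticToContinuum-17617 · crux · rank 2 · open · by planner
why it might fail: Needs a Bogoliubov-shape bound n_p ≲ √(ρa)/|p| + κN/(L²p²) in the phonon window Λ<|p|≲√(ρa) for ALL κN/L²-near-minimisers, uniformly in L — where T=0 Bogoliubov theory is infrared-divergent and no gap method reaches; a soft branch parking a fraction at momenta ↓0 slower than 1/L refutes it.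
sources: LSSY2005, VandenbergLewisPule1986, Girardeau1960, Fournais2020, FournaisEtAl2024, FournaisSolovej2020
[crux] INFRARED CAPTURE = generalised condensation of near-minimisers (piece 1 of the BC2 redirect
of the deciding crux X = JosephsonSlackCondensation; van den Berg–Lewis–Pulé's generalised
condensate, for the interacting dilute gas): for every repulsive finite-range v there is ρ₀ > 0 such
that for 0 < ρ < ρ₀ there are c, κ > 0 with: for EVERY fixed momentum scale Λ > 0, for all large N,
every Dirichlet trial state Ψ on the box of side L = (N/ρ)^{1/3} with ⟨Ψ,HΨ⟩ ≤ E₀ + κN/L² carries ≥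
cN particles in the Neumann modes u_k 1_Λ of the box with k ∈ {0} ∪ lowModes(ΛL) (momenta |p| =
π|k|/L ≤ Λ): Σ_k ⟨u_k1_Λ, γ_Ψ u_k1_Λ⟩ ≥ cN (in-tree cellOccupation / NeumannBox.mode / lowModes).
The family has ~(ΛL)³ → ∞ members, so this is NOT condensation by pigeonhole — that is exactly what
the sibling MesoscopicVacancy adds. By the in-tree sum rule n₀ + n₊^L + n₊^H = N and gap (K/L)²n₊^H
≤ T (NeumannMomentumCutoffs) plus DirichletUpperBound, capture is known technology for Λ ≥ C√(ρa);
the content is the phonon window Λ < |p| ≲ √(ρa): a Bogoliubov-shape infrared bound (n_p ≲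
√(ρa)L⁰/|p| + slack/p²) for all near-minimisers, uniformly as L → ∞ at fixed ρ. Attack:
momentum-resolved second-order lower -/
@[route_item "route-AtomisticToContinuum-BECJosephsonSlackThreshold"]
def InfraredCapture : Prop :=
  ∀ v : ℝ → ENNReal, Literature.MathematicalPhysics.QuantumManyBody.BoseGas.IsRepulsiveFiniteRange v → ∃ ρ₀ : ℝ, 0 < ρ₀ ∧ ∀ ρ : ℝ, 0 < ρ → ρ < ρ₀ → ∃ c κ : ℝ, 0 < c ∧ 0 < κ ∧ ∀ Λ : ℝ, 0 < Λ → ∀ᶠ N : ℕ in Filter.atTop, ∀ Ψ : Literature.MathematicalPhysics.QuantumManyBody.BoseGas.TrialState N (Literature.MathematicalPhysics.QuantumManyBody.BoseGas.sideLength ρ N), Literature.MathematicalPhysics.QuantumManyBody.BoseGas.energy v Ψ ≤ Literature.MathematicalPhysics.QuantumManyBody.BoseGas.groundStateEnergy v N (Literature.MathematicalPhysics.QuantumManyBody.BoseGas.sideLength ρ N) + ENNReal.ofReal (κ * N / Literature.MathematicalPhysics.QuantumManyBody.BoseGas.sideLength ρ N ^ 2) → ENNReal.ofReal (c * N) ≤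 ∑ k ∈ insert (0 : Fin 3 → ℕ) (Literature.MathematicalPhysics.QuantumManyBody.NeumannBox.lowModes (Λ * Literature.MathematicalPhysics.QuantumManyBody.BoseGas.sideLength ρ N)), Literature.MathematicalPhysics.QuantumManyBody.BoseGas.cellOccupation N (Literature.MathematicalPhysics.QuantumManyBody.BoseGas.sideLength ρ N) (fun x => ((Literature.MathematicalPhysics.QuantumManyBody.NeumannBox.mode (Literature.MathematicalPhysics.QuantumManyBody.BoseGas.sideLength ρ N) k x : ℝ) : ℂ)) Ψ.ψ

/-- item stmt-AtomisticToContinuum-17618 · crux · rank 3 · open · by planner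
why it might fail: Asserts positive phase stiffness of ALL κN/L²-near-minimisers across mesoscopic scales (superfluid density bounded below), open beyond Bogoliubov heuristics; if un-fragmenting m³ cells gains only o(m²N/L²) (soft Josephson coupling), type-II/III spreading over the window is affordable at every κ > 0.
sources: VandenbergLewisPule1986, PuleZagrebnov2004, MuellerEtAl2006, Nozieres1995, Seiringer2008, LiebSeiringerYngvason2002
[crux] MESOSCOPIC VACANCY = the generalised condensate of a near-minimiser is not spread over the
mesoscopic window (piece 2 of the BC2 redirect of X): for every repulsive finite-range v there is ρ₀
> 0 such that for 0 < ρ < ρ₀ and every θ > 0 there are K₀, Λ, κ > 0 with: for all large N, every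
Dirichlet trial state Ψ on the box of side L = (N/ρ)^{1/3} with ⟨Ψ,HΨ⟩ ≤ E₀ + κN/L² has Σ_{k ∈
{0}∪lowModes(ΛL)} ⟨u_k1_Λ, γ_Ψ u_k1_Λ⟩ ≤ Σ_{k ∈ {0}∪lowModes(K₀)} ⟨u_k1_Λ, γ_Ψ u_k1_Λ⟩ + θN — the
Neumann modes with K₀ < π|k| ≤ ΛL (wavelengths from ~1/Λ up to ~L/K₀: all mesoscopic scales) carry
at most θN. An UPPER bound on occupations: alone it certifies no occupation (no capture), and it
tolerates fragmentation INSIDE the fixed finite family {0}∪lowModes(K₀) (absorbed by pigeonhole in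
the glue, constant c/(2M)). Content: phase/amplitude STIFFNESS of near-minimisers from mesoscopic to
macroscopic scales at the Josephson scale N/L² — the converse of this route's FilterFragmentation
(fragmenting into m³ cells costs ≤ C m²N/L²; vacancy needs that un-fragmenting GAINS ≥ c m²N/L²,
i.e. positive superfluid stiffness, proved only in the GP limit, LiebSeiringerYngvason2002). Attack:
local flat condensa -/
@[route_item "route-AtomisticToContinuum-BECJosephsonSlackThreshold"]
def MesoscopicVacancy : Prop :=
  ∀ v : ℝ → ENNReal, Literature.MathematicalPhysics.QuantumManyBody.BoseGas.IsRepulsiveFiniteRange v → ∃ ρ₀ : ℝ, 0 < ρ₀ ∧ ∀ ρ : ℝ, 0 < ρ → ρ < ρ₀ → ∀ θ : ℝ, 0 < θ → ∃ K₀ Λ κ : ℝ, 0 < K₀ ∧ 0 < Λ ∧ 0 < κ ∧ ∀ᶠ N : ℕ in Filter.atTop, ∀ Ψ : Literature.MathematicalPhysics.QuantumManyBody.BoseGas.TrialState N (Literature.MathematicalPhysics.QuantumManyBody.BoseGas.sideLength ρ N), Literature.MathematicalPhysics.QuantumManyBody.BoseGas.energy v Ψ ≤ Literature.MathematicalPhysics.QuantumManyBody.BoseGas.groundStateEnergy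 v N (Literature.MathematicalPhysics.QuantumManyBody.BoseGas.sideLength ρ N) + ENNReal.ofReal (κ * N / Literature.MathematicalPhysics.QuantumManyBody.BoseGas.sideLength ρ N ^ 2) → ∑ k ∈ insert (0 : Fin 3 → ℕ) (Literature.MathematicalPhysics.QuantumManyBody.NeumannBox.lowModes (Λ * Literature.MathematicalPhysics.QuantumManyBody.BoseGas.sideLength ρ N)), Literature.MathematicalPhysics.QuantumManyBody.BoseGas.cellOccupation N (Literature.MathematicalPhysics.QuantumManyBody.BoseGas.sideLength ρ N) (fun x => ((Literature.MathematicalPhysics.QuantumManyBody.NeumannBox.mode (Literature.MathematicalPhysics.QuantumManyBody.BoseGas.sideLength ρ N) k x : ℝ) : ℂ)) Ψ.ψ ≤ (∑ k ∈ insert (0 : Fin 3 → ℕ) (Literature.MathematicalPhysics.QuantumManyBody.NeumannBox.lowModes K₀), Literature.MathematicalPhysics.QuantumManyBody.BoseGas.cellOccupation N (Literature.MathematicalPhysics.QuantumManyBody.BoseGas.sideLength ρ N) (fun x => ((Literature.MathematicalPhysics.QuantumManyBody.NeumannBox.mode (Literature.MathematicalPhysics.QuantumManyBody.BoseGas.sideLength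 ρ N) k x : ℝ) : ℂ)) Ψ.ψ) + ENNReal.ofReal (θ * N)

/-- item stmt-AtomisticToContinuum-9780 · crux · rank 4 · open · by planner
why it might fail: TL-BEC uniformly over κN/L²-near-minimisers (κ,c before N): stronger than the conjunct. Proven reach: L=C(ρa³)^{-δ}(ρa)^{-1/2}, 2δ+ε<1/2 (Fournais2020 Thm 1.2); R≲a(ρa³)^{-3/4-η/2} (Junge2026 Cor 6); no kinetic gap as L→∞ (ChongLiangNam2026 §1): a soft mode ⊥ condensate at cost o(N/L²) kills any κ.
sources: LSSY2005, Fournais2020, Junge2026, ChongLiangNam2026, FournaisEtAl2024, LiebSeiringer2002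
[crux] X, THE DECIDING CRUX (positive face of the threshold): for every repulsive finite-range v
there is ρ₀ > 0 such that for 0 < ρ < ρ₀ there are c, κ > 0 with: for all large N, EVERY Dirichlet
trial state Ψ on the box of side L = (N/ρ)^{1/3} with ⟨Ψ,HΨ⟩ ≤ E₀ + κN/L² has λ_max(γ_Ψ) ≥ cN.
Mode-free and without a linear-in-slack deficit, hence implied by BECPinning.PinnedLowerBound (given
E₀ < ⊤: occupation of u ≥ N(1 − C√(ρa³)) − N/4 ≥ N/4) and by any twist-response / Landau-sector
bound at scale N/L²; implies the conjunct by `closes`. Not decomposed here by design: this route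
supplies the proof that nothing with larger slack can replace it, and the common target the
energy-currency routes attach to. [difficulty: open-problem] -/
@[route_item "route-AtomisticToContinuum-BECJosephsonSlackThreshold", crux]
def JosephsonSlackCondensation : Prop :=
  ∀ v : ℝ → ENNReal, Literature.MathematicalPhysics.QuantumManyBody.BoseGas.IsRepulsiveFiniteRange v → ∃ ρ₀ : ℝ, 0 < ρ₀ ∧ ∀ ρ : ℝ, 0 < ρ → ρ < ρ₀ → ∃ c κ : ℝ, 0 < c ∧ 0 < κ ∧ ∀ᶠ N : ℕ in Filter.atTop, ∀ Ψ : Literature.MathematicalPhysics.QuantumManyBody.BoseGas.TrialState N (Literature.MathematicalPhysics.QuantumManyBody.BoseGas.sideLength ρ N), Literature.MathematicalPhysics.QuantumManyBody.BoseGas.energy v Ψ ≤ Literature.MathematicalPhysics.QuantumManyBody.BoseGas.groundStateEnergy v N (Literature.MathematicalPhysics.QuantumManyBody.BoseGas.sideLength ρ N) + ENNReal.ofReal (κ * N / Literature.MathematicalPhysics.QuantumManyBody.BoseGas.sideLength ρ N ^ 2) → ENNReal.ofReal (c * N) ≤ Literature.MathematicalPhysics.QuantumManyBody.BoseGas.maxOccupation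 N Ψ.ψ

/-- item stmt-AtomisticToContinuum-9778 · support · rank 2 · open · by planner
why it might fail: λ_max is bounded through the cell/layer LOADS of Φ: windows pin cell loads pointwise but layer loads only via Markov, jointly with the energy excess and window balance (weights 1/4+1/4+K⁻²<1); if the layer population could not be made ≤ εN at width L/K for concentrated Ψ, c < 4ε is out of reach.
sources: CyconEtAl1987, LSSY2005, Lewin2011, LiebSolovej2001
[crux] THE NUMBER-FILTER LEMMA (card mechanism; scale-free, model-free). For every c > 0 there are K
∈ ℕ and C ≥ 0 such that for every repulsive finite-range v, every N, every L > 0 and every Dirichlet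
trial state Ψ on Λ_L whose slab counts are concentrated — the |Ψ|²-probability that one of the K
slabs {x : x₁ ∈ [iL/K,(i+1)L/K)} holds more than 4N/K particles is ≤ 1/K² — and every slack δ with
⟨Ψ,HΨ⟩ ≤ E₀(N,L) + δ, there is a Dirichlet trial state Φ with ⟨Φ,HΦ⟩ ≤ E₀(N,L) + 4δ + C·N/L² and
λ_max(γ_Φ) ≤ cN. Construction: M = ⌈12/c⌉ cells (blocks of slabs) separated by single-slab layers,
smooth partition χ_c (Σ_c χ_c = 1, |∇χ_c| ≤ C₀K/L), smooth counts Ñ_c = Σ_j χ_c(x_j), joint filter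
F_k = Π_c f_{k_c}(Ñ_c) with Σ_k f_k² = 1, supp f_k of width 0.9 < 1, Σ_k f_k'² bounded; pointwise
IMS: Σ_k |∇(F_kΨ)|² = |∇Ψ|² + (Σ_k|∇F_k|²)|Ψ|², Σ_k|∇F_k|² ≤ C K²N/L²; Markov selection of one
window k (excess energy ≤ 4(δ + cost): weight 1/4; layer load ≤ 4·E_Ψ: weight 1/4; unbalanced
windows: weight ≤ 1/K²); in Φ = F_kΨ/‖F_kΨ‖ the coherence between distinct cell interiors vanishes
identically (f(n)f(n+1) = 0, pointwise in the other coordinates), cell loads are ≤ cN/2 on the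
support, layer load ≤ εN i -/
@[route_item "route-AtomisticToContinuum-BECJosephsonSlackThreshold", crux]
def FilterFragmentation : Prop :=
  ∀ c : ℝ, 0 < c → ∃ K : ℕ, ∃ C : ℝ, 0 < K ∧ 0 ≤ C ∧ ∀ v : ℝ → ENNReal, Literature.MathematicalPhysics.QuantumManyBody.BoseGas.IsRepulsiveFiniteRange v → ∀ (N : ℕ) (L : ℝ), 0 < L → ∀ Ψ : Literature.MathematicalPhysics.QuantumManyBody.BoseGas.TrialState N L, (∫⁻ X in {X : Literature.MathematicalPhysics.QuantumManyBody.BoseGas.Config N | ∃ i : Fin K, 4 * (N : ℝ) / K < ((Finset.univ.filter fun j : Fin N => X j 0 ∈ Set.Ico (((i : ℕ) : ℝ) * L / K) ((((i : ℕ) : ℝ) + 1) * L / K)).card : ℝ)}, (‖Ψ.ψ X‖₊ : ENNReal) ^ 2) ≤ ENNReal.ofReal (1 / (K : ℝ) ^ 2) → ∀ δ : ENNReal, Literature.MathematicalPhysics.QuantumManyBody.BoseGas.energy v Ψ ≤ Literature.MathematicalPhysics.QuantumManyBody.BoseGas.groundStateEnergy v N L + δ → ∃ Φ : Literature.MathematicalPhysics.QuantumManyBody.BoseGas.TrialState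 N L, Literature.MathematicalPhysics.QuantumManyBody.BoseGas.energy v Φ ≤ Literature.MathematicalPhysics.QuantumManyBody.BoseGas.groundStateEnergy v N L + 4 * δ + ENNReal.ofReal (C * N / L ^ 2) ∧ Literature.MathematicalPhysics.QuantumManyBody.BoseGas.maxOccupation N Φ.ψ ≤ ENNReal.ofReal (c * N)

/-- item stmt-AtomisticToContinuum-9779 · support · rank 3 · open · by planner
why it might fail: Needs E₀^Dir ≤ 4πaρN(1+o(1)) (only periodic Thm 2.2 is in tree), a SECOND-MOMENT form of the LY cell bound incl. cubes with n ≫ p particles (superadditivity blocks) and the a = 0 reduction; false if near-minimisers at slack N/L² can be Schrödinger cats of macroscopically different profiles.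
sources: LSSY2005, LiebYngvason1998, Dyson1957
[crux] For every repulsive finite-range v and every K ≥ 1 there is ρ₀ > 0 such that for 0 < ρ < ρ₀
and all large N there is a Dirichlet trial state Ψ on the box of side L = (N/ρ)^{1/3} with ⟨Ψ,HΨ⟩ ≤
E₀ + N/L² whose slab counts are concentrated in the sense of FilterFragmentation (|Ψ|²-probability
that some slab of width L/K along x₁ holds > 4N/K particles is ≤ 1/K²). Route to it: for a > 0, ANY
Ψ with slack N/L² has energy ≤ 4πaρN(1+ε) (DirichletUpperBound; N/L² = o(ρaN)), while the
state-level cell decomposition into K³ Neumann cubes of side ℓ = L/K (in tree: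
sum_locGroundStateEnergy_mul_le_setLIntegral_cellSet pattern) gives energy ≥ E_Ψ[Σ_cubes E₀^Neu(n_c,
ℓ)] with, per cube, LSSY Thm 2.4 in Neumann form (LSSY2005_lowerBound_neumann_holds: 4πa n_c²/ℓ³(1 −
CY_c^{1/17}) for n_min ≤ n_c ≤ Dn̄), superadditivity blocks for n_c > Dn̄
(LSSY2005_superadditivity.mul_le) and E₀ ≥ 0 for n_c < n_min ~ (ℓ/a)^{1/6} ≪ n̄ = N/K³; subtracting
the tangent at n̄ leaves a Huber-type deviation Σ_c E_Ψ min((n_c−n̄)², Dn̄|n_c−n̄|) ≤ C(ε + Y^{1/17}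
+ o(1))·N n̄, and Chebyshev gives the slab statement once C(ε + Y^{1/17})K⁵ is small (ρ < ρ₀(K, v),
N large); for a = 0 (v = 0 a.e., free functional) take t -/
@[route_item "route-AtomisticToContinuum-BECJosephsonSlackThreshold", crux]
def NearMinimiserSlabConcentration : Prop :=
  ∀ v : ℝ → ENNReal, Literature.MathematicalPhysics.QuantumManyBody.BoseGas.IsRepulsiveFiniteRange v → ∀ K : ℕ, 0 < K → ∃ ρ₀ : ℝ, 0 < ρ₀ ∧ ∀ ρ : ℝ, 0 < ρ → ρ < ρ₀ → ∀ᶠ N : ℕ in Filter.atTop, ∃ Ψ : Literature.MathematicalPhysics.QuantumManyBody.BoseGas.TrialState N (Literature.MathematicalPhysics.QuantumManyBody.BoseGas.sideLength ρ N), Literature.MathematicalPhysics.QuantumManyBody.BoseGas.energy v Ψ ≤ Literature.MathematicalPhysics.QuantumManyBody.BoseGas.groundStateEnergy v N (Literature.MathematicalPhysics.QuantumManyBody.BoseGas.sideLength ρ N) + ENNReal.ofReal (N / Literature.MathematicalPhysics.QuantumManyBody.BoseGas.sideLength ρ N ^ 2) ∧ (∫⁻ X in {X : Literature.MathematicalPhysics.QuantumManyBody.BoseGas.Config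 N | ∃ i : Fin K, 4 * (N : ℝ) / K < ((Finset.univ.filter fun j : Fin N => X j 0 ∈ Set.Ico (((i : ℕ) : ℝ) * Literature.MathematicalPhysics.QuantumManyBody.BoseGas.sideLength ρ N / K) ((((i : ℕ) : ℝ) + 1) * Literature.MathematicalPhysics.QuantumManyBody.BoseGas.sideLength ρ N / K)).card : ℝ)}, (‖Ψ.ψ X‖₊ : ENNReal) ^ 2) ≤ ENNReal.ofReal (1 / (K : ℝ) ^ 2)

/-- item stmt-AtomisticToContinuum-17659 · support · rank 9 · open · by planner
sources: LSSY2005, FournaisEtAl2024, VandenbergLewisPule1986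
[support] GLUE OF THE INFRARED SPLIT of the deciding crux (crux-strategist cstrat-9780; PROVABLE NOW
— candidate proof attached as evidence on stmt-9780 and on this item: SketchB.lean /
GlueCandidate.lean, lean check rc0, axioms standard, ~110 lines): InfraredCapture →
MesoscopicVacancy → JosephsonSlackCondensation. ρ₀ := min of the two; c, κ₁ from capture; vacancy at
θ := c/2 gives K₀, Λ, κ₂; capture at that very Λ; κ := min κ₁ κ₂ (the window E₀ + κN/L² is monotone
in κ); for N ≥ 1: ofReal(cN) ≤ mass({0}∪lowModes(ΛL)) ≤ mass(F) + ofReal(cN/2) with F =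
{0}∪lowModes(K₀), cancel the finite term in ℝ≥0∞ ⇒ mass(F) ≥ ofReal(cN/2); pigeonhole over F
(Finset.exists_max_image) ⇒ one member u_k1_Λ has cellOccupation ≥ ofReal(cN/2)/#F; u_k1_Λ is
a.e.-strongly measurable and L²-normalised (orthonormality
NeumannBox.setIntegral_cell_mode_mul_mode; integrability is free since a non-integrable function has
Bochner integral 0 ≠ 1) and Ψ is supported in the cell ((cellN).indicator Ψ.ψ = Ψ.ψ), so
BoseGas.occupation_le_maxOccupation gives λ_max(γ_Ψ) ≥ ofReal((c/2/#F)·N):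
JosephsonSlackCondensation with constant c/(2#F). With it JosephsonSlackCondensation is DERIVED from
the two ranked cruxes; the te -/
@[route_item "route-AtomisticToContinuum-BECJosephsonSlackThreshold"]
def JosephsonSlackCondensationOfInfraredSplit : Prop :=
  InfraredCapture → MesoscopicVacancy → JosephsonSlackCondensation

/-- item stmt-AtomisticToContinuum-9781 · support · rank 9 · open · by planner
sources: LSSY2005, LiebSolovej2001, Junge2026, Fournais2020, MuellerEtAl2006
[support] THE NEGATIVE FACE (card item N1, mode-free): per v (repulsive, finite range) and per c > 0
there are C (independent of ρ, N) and ρ₀ such that for ρ < ρ₀ and all large N some Dirichlet trial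
state on the box of side (N/ρ)^{1/3} has energy ≤ E₀ + C·N/L² and λ_max(γ) ≤ cN. Follows from
FilterFragmentation + NearMinimiserSlabConcentration by BlindnessAssembly (C := 4 + C_A(c));
candidate catalogue entry Literature/Barriers/AtomisticToContinuum/JosephsonScaleEnergyBlindness
once proved; it caps BECPinning's κ: κ(1 − c − C√(ρa³)) ≤ C(c) for every c. [difficulty: M] -/
@[route_item "route-AtomisticToContinuum-BECJosephsonSlackThreshold", crux]
def JosephsonScaleBlindness : Prop :=
  ∀ v : ℝ → ENNReal, Literature.MathematicalPhysics.QuantumManyBody.BoseGas.IsRepulsiveFiniteRange v → ∀ c : ℝ, 0 < c → ∃ C ρ₀ : ℝ, 0 < ρ₀ ∧ ∀ ρ : ℝ, 0 < ρ → ρ < ρ₀ → ∀ᶠ N : ℕ in Filter.atTop, ∃ Φ : Literature.MathematicalPhysics.QuantumManyBody.BoseGas.TrialState N (Literature.MathematicalPhysics.QuantumManyBody.BoseGas.sideLength ρ N), Literature.MathematicalPhysics.QuantumManyBody.BoseGas.energy v Φ ≤ Literature.MathematicalPhysics.QuantumManyBody.BoseGas.groundStateEnergy v N (Literature.MathematicalPhysics.QuantumManyBody.BoseGas.sideLength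 ρ N) + ENNReal.ofReal (C * N / Literature.MathematicalPhysics.QuantumManyBody.BoseGas.sideLength ρ N ^ 2) ∧ Literature.MathematicalPhysics.QuantumManyBody.BoseGas.maxOccupation N Φ.ψ ≤ ENNReal.ofReal (c * N)

/-- item stmt-AtomisticToContinuum-9782 · support · rank 9 · open · by planner
sources: LSSY2005
[support] FilterFragmentation → NearMinimiserSlabConcentration → JosephsonScaleBlindness: given v
and c take K(c), C_A(c) from the filter lemma and ρ₀(v, K) from the concentration crux; for ρ < ρ₀
and large N (N ≥ 1, so L > 0) feed the concentrated N/L²-near-minimiser to the filter with δ =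
ofReal(N/L²): slack 4N/L² + C_A N/L² = (4 + C_A)N/L². Pure logic plus ENNReal arithmetic — PROVED
sorry-free in the folder's Sketch2.lean (blindnessAssembly_holds, 20 lines) for a prover to
transcribe. [difficulty: provable-now] -/
@[route_item "route-AtomisticToContinuum-BECJosephsonSlackThreshold", crux]
def BlindnessAssembly : Prop :=
  FilterFragmentation → NearMinimiserSlabConcentration → JosephsonScaleBlindness

/-- item stmt-AtomisticToContinuum-9783 · support · rank 9 · open · by planner
sources: LSSY2005, Dyson1957, LiebSeiringerSolovejYngvason2005
[support] Leading-order Dirichlet upper bound in the thermodynamic limit: for repulsive finite-range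
v with 0 < a < ∞ (a = scattering length) and every ε > 0 there is ρ₀ > 0 such that for 0 < ρ < ρ₀
and all large N, E₀^Dir(N, (N/ρ)^{1/3}) ≤ 4πaρN(1+ε). From the in-tree periodic Thm 2.2
(LSSY2005_upperBound_periodic_holds: 4πρ₁a(1 + C a/b), a/b ~ (ρa³)^{1/3}) applied to a
translation-averaged periodic near-minimiser times a product boundary cutoff Π_j h(x_j) with h AND
∇h vanishing on ∂Λ (h = 1 at distance b = √L from the walls, so HΨ extends by zero to a C¹ Dirichlet
trial state): ∫|∇(HΨ)|² = ∫H²|∇Ψ|² − ∫HΔH|Ψ|², cost ≤ (C/b²)·E[#particles within b of the walls] =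
O(N/(bL)) = o(N), mass loss O(b/L); v ≤ v^per keeps the interaction. LSSY (2.8): e₀(ρ) is
independent of boundary conditions. [difficulty: M] -/
@[route_item "route-AtomisticToContinuum-BECJosephsonSlackThreshold", crux]
def DirichletUpperBound : Prop :=
  ∀ v : ℝ → ENNReal, Literature.MathematicalPhysics.QuantumManyBody.BoseGas.IsRepulsiveFiniteRange v → Literature.MathematicalPhysics.QuantumManyBody.BoseGas.scatteringLength v ≠ ⊤ → 0 < (Literature.MathematicalPhysics.QuantumManyBody.BoseGas.scatteringLength v).toReal → ∀ ε : ℝ, 0 < ε → ∃ ρ₀ : ℝ, 0 < ρ₀ ∧ ∀ ρ : ℝ, 0 < ρ → ρ < ρ₀ → ∀ᶠ N : ℕ in Filter.atTop, Literature.MathematicalPhysics.QuantumManyBody.BoseGas.groundStateEnergy v N (Literature.MathematicalPhysics.QuantumManyBody.BoseGas.sideLength ρ N) ≤ ENNReal.ofReal (4 * Real.pi * (Literature.MathematicalPhysics.QuantumManyBody.BoseGas.scatteringLength v).toReal * ρ * N * (1 + ε))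

/-- item stmt-AtomisticToContinuum-9784 · assembly · rank 1 · open · by planner
sources: LSSY2005, LiebSeiringerSolovejYngvason2005
[assembly] JosephsonSlackCondensation → BoseEinsteinCondensation (the sub-problem Statement decl
`_root_.BoseEinsteinCondensation`, by name); proof = `closes` (assembly_holds : Assembly := closes
in the sketch). -/
@[route_item "route-AtomisticToContinuum-BECJosephsonSlackThreshold", crux]
def Assembly : Prop :=
  JosephsonSlackCondensation → _root_.BoseEinsteinCondensation

/-! D-0027 §2.1 — DECIDING THEOREM (planner-authored via `route open/edit --closes-file`; by operator:999:377415 2026-08-15T14:36:34Z):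
its hypotheses are this route's items and its conclusion the sub-problem Statement (glue_lint), and it elaborates with this file. -/

@[closes "route-AtomisticToContinuum-BECJosephsonSlackThreshold"] theorem closes : FilterFragmentation → NearMinimiserSlabConcentration → JosephsonSlackCondensation → JosephsonScaleBlindness → BlindnessAssembly → DirichletUpperBound → Assembly → _root_.BoseEinsteinCondensation := fun h_FilterFragmentation h_NearMinimiserSlabConcentration h_JosephsonSlackCondensation h_JosephsonScaleBlindness h_BlindnessAssembly h_DirichletUpperBound h_Assembly => h_Assembly h_JosephsonSlackCondensation

end Summit.AtomisticToContinuum.BoseEinsteinCondensation.Theses.BECJosephsonSlackThreshold
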